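import Literature.MathematicalPhysics.QuantumFieldTheory.Balaban1983to89.B3Op116KernelCurrencyBox
import Literature.MathematicalPhysics.QuantumFieldTheory.Balaban1983to89.B3Op116MixedKernelRegularBox

/-!
# Bałaban, *(Higgs)₂,₃ quantum fields in a finite volume III* [B3] — THE MIXED (DIPOLE–DIPOLE) CONSTANTS OF THE (1.16) KERNEL ARE UNIFORM IN THE
LATTICE SPACING AND THE SCALE: `mixC ≤ mixCU` (torus), `mixCB ≤ mixCBU` (box, route γ′) with the U-constants explicit functions of
`(d, L, N, n_F, C, C_M, δ₁, a, θ; σ = |e|s, τ ≥ L^k|e|δ_A; M)` and of NOTHING ELSE — file «MixedCurrency» (the currency step of the mixed member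
`h_M` of (2.5) for (1.16), torus and `□`)

statement-level skeleton of published theorems with citation tags; proofs where landed; nothing here is a claim about the Yang–Mills mass gap

T. Bałaban, Commun. Math. Phys. **88** (1983) 411–445 [cite: Balaban1983Higgs3], (1.16) p. 414, Prop. 1 pp. 420–421, (2.5) p. 424, (2.10)
p. 426, p. 433; part I [cite: Balaban1982Higgs1], (3.14)–(3.16) pp. 614–615, (3.44) p. 619.  PDF held: `paper:balaban1983-higgs-2-3-quantum-fields-finite-volume`
(journal page = PDF page + 410; pp. 420–421 = `p0010.txt`–`p0011.txt`).

CITATION HEADER (lean-in-tree rule).  Cell `lit-balaban` (HOME `run/shared/lean/pub/lit-balaban/`), Phase-2 proof seat **p35** gen 29 (unit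
`lit-balaban-p35`, literature-prover-lit-balaban-p35-g29-0); free-target protocol G.5-34(d) (TAKING HOME/STATUS.md 2026-08-25T05:18Z; own lane: the
displayed constant `mixCB` of route γ′ F5-M is p35's; the torus `mixC` is p40's, whose file says «does NOT assert that the currency powers of ε
cancel or that mixC is uniform in ε or k»).  SKELETON rows **B3.Eq1.16** / **B3.Eq2.5** / **B3.Txt@433** (fold owner r15) — located members, no head
claim.  USED BY NAME, never restated: C1 `B3Op116KernelCurrencyTorus.{gE₀, convK₀, stepCU, seqCU, kapU, seqC_currency, stepC_currency, …}`, C2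
`B3Op116KernelCurrencyBox.{faceK₀, pendK₀, kapFU, stepBoxCU, stepBoxVCU, stepBoxC_currency, stepBoxVC_currency, mesh_zero_mul_kapF_le, inv_pow_pred_eq}`,
p40's `B3Op116MixedSeed.{kC, gE, seedK1, seedK2}`, `B3Op116MixedKernelRegularTorus.{dipRate, cvW, cdW, cvDip, cdDip, mixC, cvW_nonneg, cdW_nonneg,
cvDip_cdDip_nonneg, seedRate_pos_le}`, p35's `B3Op116MajorantStepBoxFar.{faceKfar, pendKfar, stepBoxCfar, stepBoxVCfar}`, `B3Op116MixedKernelRegularBox.{cK,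
cKe, shC, seedRateB, cvS, cdS, cSS, cv1, cd1, cvD, cdD, cSD, seqM, rateM, cvM, cdM, cSM, mixCB, seqM_zero, seqM_one, seqM_succ_succ, seqM_pos,
seed_consts_nonneg, seedRateB_pos_le}`, `B3Op116DKernelRegularTorus.{cK1, kap4, cvAt, cdAt, seqC_pos}`, p40's `B3Op116CollarCurrency.{pairC₀, blkK₀, faceC₀}`.

## What is printed (verbatim)

[B3] Prop. 1, pp. 420–421 [PDF 10–11]: *"The constant O(1) depends on α₀, n̄ … and is independent of ε, k, the domains Ω, Ω₁, Ω₂, the vector field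
B̃ (if they satisfy the conditions mentioned previously)."*  p. 414 [PDF 4]: *"… the Hölder norms of the covariant derivatives of this kernel … are
exponentially decaying with the distance of the arguments and are uniformly bounded by O(1)(e(L^kε)^{1−α})^{n+n′}"*.

## What this file proves, and how

DEGREES: the dipole seeds `cvW`, `cdW` of the mixed member are of degree `d + 1` in `ε` (the extra `ε` is the dipole's length), the sheets of the box
seed one degree lower; `shC = 4dε⁻¹|e|s` and `κ_F` always multiply a slot one degree up; `faceKfar ∝ (ε^{d−1})^{−1}`, `pendKfar ∝ ε^{−d}(ε^{d−1})^{−1}`;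
the displayed `mixC`, `mixCB` carry the prefactor `(ε^d)^{−1}ε^{−1}` — so with the normalisation `ν = (ε^d)^{−1}ε^{−1}` every power of `ε` cancels.
§1 the `ε`-free parts `seedK2₀`, `seedK1₀` (p40's `K₂`, `K₁` are LINEAR in their value slots: `seedK1(tc, tc′) = t·seedK1₀(c, c′)`), `faceKfar₀`,
`pendKfar₀`, and `ε·shC = 4d|e|s`, `(ε^d)^{−1}cK = C`, `(ε^d)^{−1}cKe = C(1+e)`; §2 the far steps `stepBoxCfarU` / `stepBoxVCfarU` with
**`stepBoxCfar_currency`**, **`stepBoxVCfar_currency`**; §3 the TORUS mixed member: **`cvW_currency`**, **`cdW_currency`** (`ν·cvW ≤ cvWU`,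
`ν·cdW ≤ cdWU`), **`cvDip_currency`**, **`cdDip_currency`** (one step of C1's `seqC_currency`, one `L^kε ≤ 1`), **`mixC_currency`**:
`mixC(k, a, δ₁, C, C_M, s, δ_A; M) ≤ mixCU(d, L, N, C, C_M, δ₁, a, σ, τ; M)` for `d < M`; §4 the BOX mixed member of route γ′: the seed constants
(`cvS`, `cdS`, `cSS`, `cv1`, `cd1`, `cvD`, `cdD`, `cSD`) in uniform currency, the dominating recursion **`seqMU`** / **`seqM_currency`** (state `0` =
weakened seed, state `1` = far step, state `J+2` = box step), and **`mixCB_currency`**: `mixCB(k, n_F, a, δ₁, C, C_M, s, δ_A, θ; M) ≤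
mixCBU(d, L, N, n_F, C, C_M, δ₁, a, σ, τ, θ; M)` for `d < M`, `θ > 0` — the constant `C_M = mixCB·#Ix` of the binder `h_M` on `□`
(`kernel116_mixed_cellBox_interior_le`) may be taken independent of `ε` and `k`: Prop. 1's «independent of ε, k» for the mixed members.

## Honest scope

As C1/C2: upper bounds in print's smallness parameters `|e|s`, `L^k|e|δ_A` (and `n_F`, `θ`), not the literal `O(1)(e(L^kε)p(L^kε))^{n+n′}`; the
(2.10) constant `C` and the mixed-term constant `C_M` (M1's `pmixO` hypothesis) are the (C)-plugs' ∃-constants, uniform by their quantifier order; the rate `δ₁/(4L)^{M+…}`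
is produced after `δ₁`.  Definitions are `ε`-free real constants; no `def … : Prop`, no new named fact, no `sorry`; axioms standard.  Value =
bookkeeping of located members of a by-reference step of B3 — NOT summit progress and nothing about the Yang–Mills mass gap.
-/

noncomputable section

namespace Literature.MathematicalPhysics.QuantumFieldTheory.Balaban1983to89.B3Op116MixedCurrency

open HiggsLattice (ChargeData)
open B1Eq230FluctCov (Ix)
open B1Ineq234Concrete (nCol)
open B3Op116MajorantStep (convK stepC)
open B3Op116MajorantStepBox (faceK stepBoxC stepBoxVC)
open B3Op116MajorantStepBoxFar (faceKfar pendKfar stepBoxCfar stepBoxVCfar)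
open B3Op116CollarRowReduce (kapF kapF_nonneg)
open B3Op116DKernelRegularTorus (cK1 kap4 kap4_nonneg cvAt cdAt seqC_pos)
open B3Op116MixedSeed (kC gE seedK1 seedK2)
open B3Op116MixedKernelRegularTorus (dipRate cvW cdW cvDip cdDip mixC cvW_nonneg cdW_nonneg cvDip_cdDip_nonneg seedRate_pos_le)
open B3Op116MixedKernelRegularBox (cK cKe shC seedRateB cvS cdS cSS cv1 cd1 cvD cdD cSD seqM rateM cvM cdM cSM mixCB seqM_zero seqM_one
  seqM_succ_succ seqM_pos seed_consts_nonneg seedRateB_pos_le)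
open B3Op116CollarCurrency (pairC₀ blkK₀ faceC₀ pairC₀_nonneg faceC₀_nonneg)
open B3Op116KernelCurrencyTorus (gE₀ gE₀_nonneg convK₀ convK₀_nonneg convK_eq blkK₀_nonneg' stepCU stepC_currency seqCU kapU kapU_nonneg
  seqC_currency mesh_mul_kap4_le inv_mul_cK1_le inv_mul_cK2_eq mesh_mul_inv_mesh_zero_mul mesh_zero_le_mesh)
open B3Op116KernelCurrencyBox (faceK₀ faceK₀_nonneg faceK_eq pendK₀ kapFU kapFU_nonneg mesh_zero_mul_kapF_le stepBoxCU stepBoxVCU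
  stepBoxC_currency stepBoxVC_currency inv_pow_pred_eq)

variable {P : HiggsLattice.Params} {N : ℕ}

/-! ## §1 The `ε`-free parts of the mixed seed's constants -/

section EpsFree

/-- `gE = gE₀` and `kC = pairC₀` (definitional). [cite: Balaban1983Higgs3, (2.6) p.424, (2.10) p.426] -/
theorem gE_eq (e : ℝ) : gE P e = gE₀ (P.L : ℝ) e := rfl

/-- `kC = pairC₀` (definitional). [cite: Balaban1983Higgs3, (2.10) p.426] -/
theorem kC_eq (δ : ℝ) : kC P N δ = pairC₀ P.d N δ := rfl

/-- the `ε`-free form of p40's row constant `K₂` (same body, `d`, `L` explicit). [cite: Balaban1983Higgs3, (1.16) p.414] [cite: Balaban1982Higgs1, (2.23) p.610, (3.16) p.615] -/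
def seedK2₀ (d : ℕ) (L : ℝ) (N : ℕ) (δ₁ Cst aw cw : ℝ) : ℝ :=
  (gE₀ L aw + gE₀ L 1) * ((d : ℝ) * (Cst * cw * pairC₀ d N δ₁))

/-- the `ε`-free form of p40's row constant `K₁` (same body, `d`, `L` explicit). [cite: Balaban1983Higgs3, (1.16) p.414] [cite: Balaban1982Higgs1, (3.14)–(3.16) pp.614–615] -/
def seedK1₀ (d : ℕ) (L : ℝ) (N : ℕ) (δ₁ Cst CM a aw cw cw' : ℝ) : ℝ :=
  gE₀ L 1 * ((d : ℝ) * (Real.exp 1 * Cst * cw' * pairC₀ d N δ₁)) + gE₀ L aw * ((d : ℝ) * (CM * cw * pairC₀ d N δ₁))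
  + (gE₀ L aw * ((d : ℝ) * (CM * Real.exp 1 * cw * pairC₀ d N δ₁)) + gE₀ L 1 * ((d : ℝ) * (Cst * cw' * pairC₀ d N δ₁)))
  + (d : ℝ) * (Real.exp 1 * Cst * (Real.exp 1 * cw) * (pairC₀ d N δ₁ * (gE₀ L 1 + gE₀ L aw)))
  + a * ((d : ℝ) * (2 + d)) * (1 + L ^ (aw - (d : ℝ))) * (Cst * (blkK₀ d L N δ₁ aw * cw) * (pairC₀ d N (δ₁ / 2) * (gE₀ L 1 + gE₀ L aw)))

/-- `K₂` is linear in its value slot: `seedK2(…, t·c) = t·seedK2₀(…, c)`. [cite: Balaban1983Higgs3, (1.16) p.414] -/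
theorem seedK2_smul (δ₁ Cst aw t c : ℝ) : seedK2 P N δ₁ Cst aw (t * c) = t * seedK2₀ P.d (P.L : ℝ) N δ₁ Cst aw c := by
  unfold seedK2 seedK2₀; rw [gE_eq, gE_eq, kC_eq]; ring

/-- `K₁` is linear in its two value slots: `seedK1(…, t·c, t·c′) = t·seedK1₀(…, c, c′)`. [cite: Balaban1983Higgs3, (1.16) p.414] -/
theorem seedK1_smul (δ₁ Cst CM a aw t c c' : ℝ) :
    seedK1 P N δ₁ Cst CM a aw (t * c) (t * c') = t * seedK1₀ P.d (P.L : ℝ) N δ₁ Cst CM a aw c c' := by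
  unfold seedK1 seedK1₀ blkK₀; rw [gE_eq, gE_eq, kC_eq, kC_eq]; ring

/-- `seedK2₀ ≥ 0` (`L ≥ 1`, `δ₁ > 0`, `aw ≥ 0`, `C, c ≥ 0`). [cite: Balaban1983Higgs3, (1.16) p.414] -/
theorem seedK2₀_nonneg {d : ℕ} {L : ℝ} (hL : 1 ≤ L) (N : ℕ) {δ₁ Cst aw cw : ℝ} (hδ₁ : 0 < δ₁) (hCst : 0 ≤ Cst) (haw : 0 ≤ aw) (hcw : 0 ≤ cw) :
    0 ≤ seedK2₀ d L N δ₁ Cst aw cw := by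
  have h1 := gE₀_nonneg hL haw
  have h2 := gE₀_nonneg hL zero_le_one
  have h3 := pairC₀_nonneg d N hδ₁
  unfold seedK2₀
  positivity

/-- `seedK1₀ ≥ 0` (`L > 1`, `δ₁ > 0`, `aw > 0`, `C, C_M, a, c, c′ ≥ 0`). [cite: Balaban1983Higgs3, (1.16) p.414] -/
theorem seedK1₀_nonneg {d : ℕ} {L : ℝ} (hL : 1 < L) (N : ℕ) {δ₁ Cst CM a aw cw cw' : ℝ} (hδ₁ : 0 < δ₁) (hCst : 0 ≤ Cst) (hCM : 0 ≤ CM)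
    (ha : 0 ≤ a) (haw : 0 < aw) (hcw : 0 ≤ cw) (hcw' : 0 ≤ cw') : 0 ≤ seedK1₀ d L N δ₁ Cst CM a aw cw cw' := by
  have hL0 : 0 ≤ L := by linarith
  have h1 := gE₀_nonneg hL.le haw.le
  have h2 := gE₀_nonneg hL.le zero_le_one
  have h3 := pairC₀_nonneg d N hδ₁
  have h4 := pairC₀_nonneg d N (half_pos hδ₁)
  have h5 := blkK₀_nonneg' (d := d) hL N hδ₁ haw
  have h6 : 0 ≤ L ^ (aw - (d : ℝ)) := Real.rpow_nonneg hL0 _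
  have he : 0 ≤ Real.exp 1 := Real.exp_nonneg _
  unfold seedK1₀
  positivity

/-- `faceKfar₀(d, L, δ, s, r, θ) = (8d/δ)^{d−1}·(θ^{s−1}(1+4d/δ)r₁/(1−r₁) + L^{r−1}/(L^{r−1}−1))`, `r₁ = e^{−(δ/2)θ(L−1)/(2d)}`, the `ε`-free part of
`faceKfar`. [cite: Balaban1983Higgs3, (2.6) p.424, (2.10)–(2.11) p.426, p.433] -/
def faceKfar₀ (d : ℕ) (L : ℝ) (δ s r θ : ℝ) : ℝ :=
  faceC₀ d δ * (θ ^ (s - 1) * ((1 + 4 * d / δ) *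
      (Real.exp (-(δ / 2 * θ * (L - 1) / (2 * d))) / (1 - Real.exp (-(δ / 2 * θ * (L - 1) / (2 * d))))))
    + L ^ (r - 1) / (L ^ (r - 1) - 1))

/-- `faceKfar = faceKfar₀·ε·(ε^d)^{−1}`. [cite: Balaban1983Higgs3, (2.10) p.426] -/
theorem faceKfar_eq (δ s r θ : ℝ) : faceKfar P δ s r θ = faceKfar₀ P.d (P.L : ℝ) δ s r θ * (P.mesh 0 * (P.mesh 0 ^ P.d)⁻¹) := by
  rw [← inv_pow_pred_eq]
  unfold faceKfar faceKfar₀ faceC₀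
  ring

/-- `faceKfar₀ ≥ 0` for `L > 1`, `δ, θ > 0`, `r ≥ 1`. [cite: Balaban1983Higgs3, (2.10) p.426] -/
theorem faceKfar₀_nonneg {d : ℕ} (hd : 1 ≤ d) {L : ℝ} (hL : 1 < L) {δ s r θ : ℝ} (hδ : 0 < δ) (hθ : 0 < θ) (hr : 1 ≤ r) :
    0 ≤ faceKfar₀ d L δ s r θ := by
  have hd0 : (0 : ℝ) < (d : ℝ) := by exact_mod_cast hd
  have hx : 0 < δ / 2 * θ * (L - 1) / (2 * (d : ℝ)) := div_pos (mul_pos (mul_pos (half_pos hδ) hθ) (by linarith)) (by positivity)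
  have h1 : Real.exp (-(δ / 2 * θ * (L - 1) / (2 * (d : ℝ)))) < 1 := Real.exp_lt_one_iff.mpr (by linarith)
  have htail : 0 ≤ Real.exp (-(δ / 2 * θ * (L - 1) / (2 * (d : ℝ)))) / (1 - Real.exp (-(δ / 2 * θ * (L - 1) / (2 * (d : ℝ))))) :=
    div_nonneg (Real.exp_nonneg _) (by linarith)
  have h2 : 0 ≤ L ^ (r - 1) / (L ^ (r - 1) - 1) := gE₀_nonneg hL.le (by linarith : 0 ≤ r - 1)
  have h3 : 0 ≤ θ ^ (s - 1) := Real.rpow_nonneg hθ.le _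
  unfold faceKfar₀
  exact mul_nonneg (faceC₀_nonneg d hδ) (add_nonneg (mul_nonneg h3 (mul_nonneg (by positivity) htail)) h2)

/-- `pendKfar₀(d, L, N, δ, p, s, θ) = convK₀(δ, p, 1)·faceKfar₀(δ/2, s, p+1, θ)`, the `ε`-free part of `pendKfar`. [cite: Balaban1983Higgs3, (2.6) p.424, (2.10) p.426] -/
def pendKfar₀ (d : ℕ) (L : ℝ) (N : ℕ) (δ p s θ : ℝ) : ℝ := convK₀ d L N δ p 1 * faceKfar₀ d L (δ / 2) s (p + 1) θ

/-- `pendKfar = pendKfar₀·ε·(ε^d)^{−2}`. [cite: Balaban1983Higgs3, (2.10) p.426] -/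
theorem pendKfar_eq (δ p s θ : ℝ) :
    pendKfar P N δ p s θ = pendKfar₀ P.d (P.L : ℝ) N δ p s θ * (P.mesh 0 * ((P.mesh 0 ^ P.d)⁻¹ * (P.mesh 0 ^ P.d)⁻¹)) := by
  unfold pendKfar pendKfar₀
  rw [convK_eq, faceKfar_eq]
  ring

/-- `pendKfar₀ ≥ 0` for `L > 1`, `δ, θ > 0`, `p ≥ 0`. [cite: Balaban1983Higgs3, (2.10) p.426] -/
theorem pendKfar₀_nonneg {d : ℕ} (hd : 1 ≤ d) {L : ℝ} (hL : 1 < L) (N : ℕ) {δ p s θ : ℝ} (hδ : 0 < δ) (hp : 0 ≤ p) (hθ : 0 < θ) :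
    0 ≤ pendKfar₀ d L N δ p s θ :=
  mul_nonneg (convK₀_nonneg hL.le N hδ hp zero_le_one) (faceKfar₀_nonneg hd hL (half_pos hδ) hθ (by linarith))

/-- `(ε^d)^{−1}·cK = C`. [cite: Balaban1983Higgs3, (2.10) p.426] -/
theorem inv_mul_cK (Cst : ℝ) : (P.mesh 0 ^ P.d)⁻¹ * cK P Cst = Cst := inv_mul_cK2_eq (P := P) Cst

/-- `(ε^d)^{−1}·cKe = C(1+e)`. [cite: Balaban1983Higgs3, (2.10) p.426] [cite: Balaban1982Higgs1, (3.14) p.614] -/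
theorem inv_mul_cKe (Cst : ℝ) : (P.mesh 0 ^ P.d)⁻¹ * cKe P Cst = Cst * (1 + Real.exp 1) := by
  unfold cKe; rw [← mul_assoc, inv_mul_cK]

/-- `ε·shC = 4d|e|s`. [cite: Balaban1983Higgs3, (1.16) p.414, p.433] -/
theorem mesh_zero_mul_shC (C : ChargeData N) (s : ℝ) : P.mesh 0 * shC P C s = 4 * (P.d : ℝ) * (|C.e| * s) := by
  have hε : P.mesh 0 ≠ 0 := (P.mesh_pos 0).ne'
  unfold shC; field_simp

/-- `(ε^d)^{−1}ε^{−1}·ε = (ε^d)^{−1}`: the sheet normalisation of the dipole currency. [cite: Balaban1983Higgs3, (2.10) p.426] -/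
theorem nu_mul_mesh_zero : (P.mesh 0 ^ P.d)⁻¹ * (P.mesh 0)⁻¹ * P.mesh 0 = (P.mesh 0 ^ P.d)⁻¹ := by
  have hε : P.mesh 0 ≠ 0 := (P.mesh_pos 0).ne'
  rw [mul_assoc, inv_mul_cancel₀ hε, mul_one]

end EpsFree

/-! ## §2 The far steps in uniform currency -/

section FarStep

/-- **the uniform twin of `stepBoxCfar`**: C1's `stepCU` plus the two pending pairings with the far-anchored constant `pendKfar₀`.
[cite: Balaban1983Higgs3, (1.16) p.414, Prop. 1 pp.420–421, (2.10) p.426, p.433] -/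
def stepBoxCfarU (d : ℕ) (L : ℝ) (N : ℕ) (nF : ℕ) (δ aK av Ĉ v w S Ĉ₁ κ₁ τ κ₃ K₄ θ : ℝ) : ℝ :=
  stepCU d L N δ aK av Ĉ v w κ₁ τ κ₃ K₄
    + (d : ℝ) * ((nF : ℝ) * (κ₁ * ((Real.exp 1 * Ĉ * Ĉ₁ * S + Ĉ * Ĉ₁ * S) * pendKfar₀ d L N δ aK (av - 1) θ)))

/-- **the uniform twin of `stepBoxVCfar`**: `stepBoxCfarU` plus the resolved face charges. [cite: Balaban1983Higgs3, (1.16) p.414, Prop. 1 pp.420–421, (2.10) p.426, p.433] -/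
def stepBoxVCfarU (d : ℕ) (L : ℝ) (N : ℕ) (nF : ℕ) (δ aK av Ĉ v w S Ĉ₁ κ₁ τ κ₃ K₄ KF θ : ℝ) : ℝ :=
  stepBoxCfarU d L N nF δ aK av Ĉ v w S Ĉ₁ κ₁ τ κ₃ K₄ θ + (nF : ℝ) * (KF * (Ĉ * v * faceK₀ d L δ aK av))

/-- monotonicity of a product of three nonnegative factors against a fixed nonnegative multiplier (folklore analysis). [cite: Balaban1983Higgs3, (2.10) p.426] -/
private theorem prod3_le {a b c a' b' c' m : ℝ} (ha : 0 ≤ a) (hb : 0 ≤ b) (hc : 0 ≤ c) (hm : 0 ≤ m)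
    (ha' : a ≤ a') (hb' : b ≤ b') (hc' : c ≤ c') : a * (b * c) * m ≤ a' * (b' * c') * m := by
  have hbc : b * c ≤ b' * c' := mul_le_mul hb' hc' hc (hb.trans hb')
  exact mul_le_mul_of_nonneg_right (mul_le_mul ha' hbc (mul_nonneg hb hc) (ha.trans ha')) hm

variable {k nF : ℕ} {δ aK av ν cK' cv cd cS c₁ Ĉ v w S Ĉ₁ κ₁ κ₂ κ₃ κ₄ τ K₄ κF KF θ : ℝ}

/-- **THE FAR STEP, DERIVATIVE COLUMN, IN UNIFORM CURRENCY** (`a_K > 0`, `a_v > 1`, `θ > 0`; hypotheses as C2's `stepBoxC_currency`):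
`ν·stepBoxCfar(…, θ) ≤ stepBoxCfarU(…, θ)`. [cite: Balaban1983Higgs3, (1.16) p.414, Prop. 1 pp.420–421, (2.10) p.426, p.433] -/
theorem stepBoxCfar_currency (hL : 1 < P.L) (hmesh : P.mesh k ≤ 1) (hδ : 0 < δ) (haK : 0 < aK) (hav : 1 < av) (hθ : 0 < θ)
    (hν : 0 ≤ ν) (hcK : 0 ≤ cK') (hĈ : (P.mesh 0 ^ P.d)⁻¹ * cK' ≤ Ĉ) (hcv : 0 ≤ cv) (hv : ν * cv ≤ v) (hcd : 0 ≤ cd) (hw : ν * cd ≤ w)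
    (hcS : 0 ≤ cS) (hS : ν * P.mesh 0 * cS ≤ S) (hc₁ : 0 ≤ c₁) (hĈ₁ : (P.mesh 0 ^ P.d)⁻¹ * c₁ ≤ Ĉ₁)
    (hκ₁ : 0 ≤ κ₁) (hκ₂ : 0 ≤ κ₂) (hτ : P.mesh k * κ₂ ≤ τ) (hκ₃ : 0 ≤ κ₃) (hκ₄ : 0 ≤ κ₄) (hK₄ : P.mesh k * κ₄ ≤ K₄) :
    ν * stepBoxCfar P N k nF δ aK av cK' cv cd cS c₁ κ₁ κ₂ κ₃ κ₄ θ ≤ stepBoxCfarU P.d (P.L : ℝ) N nF δ aK av Ĉ v w S Ĉ₁ κ₁ τ κ₃ K₄ θ := by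
  have hL1 : (1 : ℝ) < (P.L : ℝ) := by exact_mod_cast hL
  have hE : 0 ≤ (P.mesh 0 ^ P.d)⁻¹ := inv_nonneg.mpr (pow_nonneg (P.mesh_pos 0).le _)
  have hε : 0 ≤ P.mesh 0 := (P.mesh_pos 0).le
  have hstep := stepC_currency (N := N) hL hmesh hδ haK hav hν hcK hĈ hcv hv hcd hw hκ₁ hκ₂ hτ hκ₃ hκ₄ hK₄
  have hP : 0 ≤ pendKfar₀ P.d (P.L : ℝ) N δ aK (av - 1) θ := pendKfar₀_nonneg P.hd hL1 N hδ haK.le hθ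
  have hX0 : 0 ≤ (P.mesh 0 ^ P.d)⁻¹ * cK' := mul_nonneg hE hcK
  have hX1 : 0 ≤ (P.mesh 0 ^ P.d)⁻¹ * c₁ := mul_nonneg hE hc₁
  have hXS : 0 ≤ ν * P.mesh 0 * cS := mul_nonneg (mul_nonneg hν hε) hcS
  have hid : ν * stepBoxCfar P N k nF δ aK av cK' cv cd cS c₁ κ₁ κ₂ κ₃ κ₄ θ =
      ν * stepC P N k δ aK av cK' cv cd κ₁ κ₂ κ₃ κ₄
        + ((P.mesh 0 ^ P.d)⁻¹ * cK') * (((P.mesh 0 ^ P.d)⁻¹ * c₁) * (ν * P.mesh 0 * cS)) *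
            ((P.d : ℝ) * (nF : ℝ) * κ₁ * (Real.exp 1 + 1) * pendKfar₀ P.d (P.L : ℝ) N δ aK (av - 1) θ) := by
    unfold stepBoxCfar
    rw [pendKfar_eq]
    ring
  have hU : stepBoxCfarU P.d (P.L : ℝ) N nF δ aK av Ĉ v w S Ĉ₁ κ₁ τ κ₃ K₄ θ =
      stepCU P.d (P.L : ℝ) N δ aK av Ĉ v w κ₁ τ κ₃ K₄
        + Ĉ * (Ĉ₁ * S) * ((P.d : ℝ) * (nF : ℝ) * κ₁ * (Real.exp 1 + 1) * pendKfar₀ P.d (P.L : ℝ) N δ aK (av - 1) θ) := by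
    unfold stepBoxCfarU
    ring
  rw [hid, hU]
  exact add_le_add hstep (prod3_le hX0 hX1 hXS (by positivity) hĈ hĈ₁ hS)

/-- **THE FAR STEP, VALUE COLUMN, IN UNIFORM CURRENCY** (`a_K ≥ 1` in addition, and `ε·κ_F ≤ K_F`): `ν·stepBoxVCfar(…, κ_F, θ) ≤ stepBoxVCfarU(…, K_F, θ)`.
[cite: Balaban1983Higgs3, (1.16) p.414, Prop. 1 pp.420–421, (2.10) p.426, p.433] -/
theorem stepBoxVCfar_currency (hL : 1 < P.L) (hmesh : P.mesh k ≤ 1) (hδ : 0 < δ) (haK : 1 ≤ aK) (hav : 1 < av) (hθ : 0 < θ)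
    (hν : 0 ≤ ν) (hcK : 0 ≤ cK') (hĈ : (P.mesh 0 ^ P.d)⁻¹ * cK' ≤ Ĉ) (hcv : 0 ≤ cv) (hv : ν * cv ≤ v) (hcd : 0 ≤ cd) (hw : ν * cd ≤ w)
    (hcS : 0 ≤ cS) (hS : ν * P.mesh 0 * cS ≤ S) (hc₁ : 0 ≤ c₁) (hĈ₁ : (P.mesh 0 ^ P.d)⁻¹ * c₁ ≤ Ĉ₁)
    (hκ₁ : 0 ≤ κ₁) (hκ₂ : 0 ≤ κ₂) (hτ : P.mesh k * κ₂ ≤ τ) (hκ₃ : 0 ≤ κ₃) (hκ₄ : 0 ≤ κ₄) (hK₄ : P.mesh k * κ₄ ≤ K₄)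
    (hκF : 0 ≤ κF) (hKF : P.mesh 0 * κF ≤ KF) :
    ν * stepBoxVCfar P N k nF δ aK av cK' cv cd cS c₁ κ₁ κ₂ κ₃ κ₄ κF θ ≤ stepBoxVCfarU P.d (P.L : ℝ) N nF δ aK av Ĉ v w S Ĉ₁ κ₁ τ κ₃ K₄ KF θ := by
  have hL1 : (1 : ℝ) < (P.L : ℝ) := by exact_mod_cast hL
  have hE : 0 ≤ (P.mesh 0 ^ P.d)⁻¹ := inv_nonneg.mpr (pow_nonneg (P.mesh_pos 0).le _)
  have hε : 0 ≤ P.mesh 0 := (P.mesh_pos 0).le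
  have hstep := stepBoxCfar_currency (N := N) (nF := nF) hL hmesh hδ (by linarith : 0 < aK) hav hθ hν hcK hĈ hcv hv hcd hw hcS hS hc₁ hĈ₁ hκ₁
    hκ₂ hτ hκ₃ hκ₄ hK₄
  have hF : 0 ≤ faceK₀ P.d (P.L : ℝ) δ aK av := faceK₀_nonneg hL1.le hδ haK hav.le
  have hX0 : 0 ≤ (P.mesh 0 ^ P.d)⁻¹ * cK' := mul_nonneg hE hcK
  have hXF : 0 ≤ P.mesh 0 * κF := mul_nonneg hε hκF
  have hY0 : 0 ≤ ν * cv := mul_nonneg hν hcv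
  have hid : ν * stepBoxVCfar P N k nF δ aK av cK' cv cd cS c₁ κ₁ κ₂ κ₃ κ₄ κF θ =
      ν * stepBoxCfar P N k nF δ aK av cK' cv cd cS c₁ κ₁ κ₂ κ₃ κ₄ θ
        + (P.mesh 0 * κF) * (((P.mesh 0 ^ P.d)⁻¹ * cK') * (ν * cv)) * ((nF : ℝ) * faceK₀ P.d (P.L : ℝ) δ aK av) := by
    unfold stepBoxVCfar
    rw [faceK_eq]
    ring
  have hU : stepBoxVCfarU P.d (P.L : ℝ) N nF δ aK av Ĉ v w S Ĉ₁ κ₁ τ κ₃ K₄ KF θ =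
      stepBoxCfarU P.d (P.L : ℝ) N nF δ aK av Ĉ v w S Ĉ₁ κ₁ τ κ₃ K₄ θ + KF * (Ĉ * v) * ((nF : ℝ) * faceK₀ P.d (P.L : ℝ) δ aK av) := by
    unfold stepBoxVCfarU
    ring
  rw [hid, hU]
  exact add_le_add hstep (prod3_le hXF hX0 hY0 (by positivity) hKF hĈ hv)

end FarStep

/-! ## §3 The torus mixed member in uniform currency -/

section Torus

/-- the uniform twin of the dipole seed's value constant `cvW`: `#Ix·(σ·K₁(2; C, C(1+e)) + τ·K₂(2; C))`. [cite: Balaban1983Higgs3, (1.16) p.414, (2.10) p.426] -/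
def cvWU (d : ℕ) (L : ℝ) (N : ℕ) (Cst CM δ₁ a σ τ : ℝ) : ℝ :=
  (Fintype.card (Ix N) : ℝ) * (σ * seedK1₀ d L N δ₁ Cst CM a 2 Cst (Cst * (1 + Real.exp 1)) + τ * seedK2₀ d L N δ₁ Cst 2 Cst)

/-- the uniform twin of the dipole seed's row constant `cdW`. [cite: Balaban1983Higgs3, (1.16) p.414, (2.10) p.426] -/
def cdWU (d : ℕ) (L : ℝ) (N : ℕ) (Cst CM δ₁ a σ τ : ℝ) : ℝ :=
  σ * seedK1₀ d L N δ₁ Cst CM a 1 (Cst * (1 + Real.exp 1)) (CM + Cst * Real.exp 1 + Cst * (1 + Real.exp 1) * Real.exp 1)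
    + τ * seedK2₀ d L N δ₁ Cst 1 (Cst * (1 + Real.exp 1))

variable {C : ChargeData N} {k : ℕ} {a δ₁ Cst CM s δA τ : ℝ}

/-- **`(ε^d)^{−1}ε^{−1}·cvW ≤ cvWU`** (`L^k|e|δ_A ≤ τ`; the `K₁` part is an identity, by linearity). [cite: Balaban1983Higgs3, (1.16) p.414, Prop. 1 pp.420–421] -/
theorem cvW_currency (hL : 1 < P.L) (hδ₁ : 0 < δ₁) (hCst : 0 ≤ Cst) (hτ : (P.L : ℝ) ^ k * (|C.e| * δA) ≤ τ) :
    (P.mesh 0 ^ P.d)⁻¹ * (P.mesh 0)⁻¹ * cvW P N C k a δ₁ Cst CM s δA ≤ cvWU P.d (P.L : ℝ) N Cst CM δ₁ a (|C.e| * s) τ := by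
  have hL1 : (1 : ℝ) < (P.L : ℝ) := by exact_mod_cast hL
  have hE0 : P.mesh 0 ^ P.d ≠ 0 := (pow_pos (P.mesh_pos 0) _).ne'
  have hε0 : P.mesh 0 ≠ 0 := (P.mesh_pos 0).ne'
  have h1 : seedK1 P N δ₁ Cst CM a 2 (P.mesh 0 ^ P.d * Cst) (P.mesh 0 ^ P.d * Cst * (1 + Real.exp 1))
      = P.mesh 0 ^ P.d * seedK1₀ P.d (P.L : ℝ) N δ₁ Cst CM a 2 Cst (Cst * (1 + Real.exp 1)) := by
    rw [mul_assoc]; exact seedK1_smul _ _ _ _ _ _ _ _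
  have h2 : seedK2 P N δ₁ Cst 2 (P.mesh 0 ^ P.d * Cst) = P.mesh 0 ^ P.d * seedK2₀ P.d (P.L : ℝ) N δ₁ Cst 2 Cst := seedK2_smul _ _ _ _ _
  have hid : (P.mesh 0 ^ P.d)⁻¹ * (P.mesh 0)⁻¹ * cvW P N C k a δ₁ Cst CM s δA =
      (Fintype.card (Ix N) : ℝ) * (|C.e| * s * seedK1₀ P.d (P.L : ℝ) N δ₁ Cst CM a 2 Cst (Cst * (1 + Real.exp 1))
        + (P.L : ℝ) ^ k * (|C.e| * δA) * seedK2₀ P.d (P.L : ℝ) N δ₁ Cst 2 Cst) := by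
    unfold cvW; rw [h1, h2]; field_simp
  rw [hid]
  unfold cvWU
  have hK2 : 0 ≤ seedK2₀ P.d (P.L : ℝ) N δ₁ Cst 2 Cst := seedK2₀_nonneg hL1.le N hδ₁ hCst (by norm_num) hCst
  refine mul_le_mul_of_nonneg_left ?_ (Nat.cast_nonneg _)
  nlinarith [mul_le_mul_of_nonneg_right hτ hK2]

/-- **`(ε^d)^{−1}ε^{−1}·cdW ≤ cdWU`** (`L^k|e|δ_A ≤ τ`). [cite: Balaban1983Higgs3, (1.16) p.414, Prop. 1 pp.420–421] -/
theorem cdW_currency (hL : 1 < P.L) (hδ₁ : 0 < δ₁) (hCst : 0 ≤ Cst) (hτ : (P.L : ℝ) ^ k * (|C.e| * δA) ≤ τ) :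
    (P.mesh 0 ^ P.d)⁻¹ * (P.mesh 0)⁻¹ * cdW P N C k a δ₁ Cst CM s δA ≤ cdWU P.d (P.L : ℝ) N Cst CM δ₁ a (|C.e| * s) τ := by
  have hL1 : (1 : ℝ) < (P.L : ℝ) := by exact_mod_cast hL
  have hE0 : P.mesh 0 ^ P.d ≠ 0 := (pow_pos (P.mesh_pos 0) _).ne'
  have hε0 : P.mesh 0 ≠ 0 := (P.mesh_pos 0).ne'
  have h1 : seedK1 P N δ₁ Cst CM a 1 (P.mesh 0 * 1 * ((P.mesh 0 ^ P.d * Cst) * (1 + Real.exp 1)))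
      (P.mesh 0 * 1 * (P.mesh 0 ^ P.d * CM + (P.mesh 0 ^ P.d * Cst) * Real.exp 1 + (P.mesh 0 ^ P.d * Cst) * (1 + Real.exp 1) * Real.exp 1))
      = (P.mesh 0 * P.mesh 0 ^ P.d) *
        seedK1₀ P.d (P.L : ℝ) N δ₁ Cst CM a 1 (Cst * (1 + Real.exp 1)) (CM + Cst * Real.exp 1 + Cst * (1 + Real.exp 1) * Real.exp 1) := by
    rw [show P.mesh 0 * 1 * ((P.mesh 0 ^ P.d * Cst) * (1 + Real.exp 1)) = (P.mesh 0 * P.mesh 0 ^ P.d) * (Cst * (1 + Real.exp 1)) by ring,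
      show P.mesh 0 * 1 * (P.mesh 0 ^ P.d * CM + (P.mesh 0 ^ P.d * Cst) * Real.exp 1 + (P.mesh 0 ^ P.d * Cst) * (1 + Real.exp 1) * Real.exp 1)
        = (P.mesh 0 * P.mesh 0 ^ P.d) * (CM + Cst * Real.exp 1 + Cst * (1 + Real.exp 1) * Real.exp 1) by ring]
    exact seedK1_smul _ _ _ _ _ _ _ _
  have h2 : seedK2 P N δ₁ Cst 1 (P.mesh 0 * 1 * ((P.mesh 0 ^ P.d * Cst) * (1 + Real.exp 1)))
      = (P.mesh 0 * P.mesh 0 ^ P.d) * seedK2₀ P.d (P.L : ℝ) N δ₁ Cst 1 (Cst * (1 + Real.exp 1)) := by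
    rw [show P.mesh 0 * 1 * ((P.mesh 0 ^ P.d * Cst) * (1 + Real.exp 1)) = (P.mesh 0 * P.mesh 0 ^ P.d) * (Cst * (1 + Real.exp 1)) by ring]
    exact seedK2_smul _ _ _ _ _
  have hid : (P.mesh 0 ^ P.d)⁻¹ * (P.mesh 0)⁻¹ * cdW P N C k a δ₁ Cst CM s δA =
      |C.e| * s * seedK1₀ P.d (P.L : ℝ) N δ₁ Cst CM a 1 (Cst * (1 + Real.exp 1)) (CM + Cst * Real.exp 1 + Cst * (1 + Real.exp 1) * Real.exp 1)
        + (P.L : ℝ) ^ k * (|C.e| * δA) * seedK2₀ P.d (P.L : ℝ) N δ₁ Cst 1 (Cst * (1 + Real.exp 1)) := by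
    unfold cdW; rw [h1, h2]; field_simp
  rw [hid]
  unfold cdWU
  have hK2 : 0 ≤ seedK2₀ P.d (P.L : ℝ) N δ₁ Cst 1 (Cst * (1 + Real.exp 1)) :=
    seedK2₀_nonneg hL1.le N hδ₁ hCst (by norm_num) (by positivity)
  nlinarith [mul_le_mul_of_nonneg_right hτ hK2]

/-- the uniform twin of `cvDip`: `cvWU + (seqCU … 1).2.1` (one step from the seed `(δ₁/(4L); cvWU, cdWU)`, one `L^kε ≤ 1`). [cite: Balaban1983Higgs3, (1.16) p.414, (2.10) p.426] -/
def cvDipU (d : ℕ) (L : ℝ) (N : ℕ) (Cst CM δ₁ a σ τ : ℝ) : ℝ :=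
  cvWU d L N Cst CM δ₁ a σ τ
    + (seqCU d L N Cst (Cst * (1 + Real.exp 1 * σ)) σ τ (σ ^ 2) (kapU d a σ) (δ₁ / 2 / 2 / L)
        (cvWU d L N Cst CM δ₁ a σ τ) (cdWU d L N Cst CM δ₁ a σ τ) 1).2.1

/-- the uniform twin of `cdDip`: `cdWU + (seqCU … 1).2.2`. [cite: Balaban1983Higgs3, (1.16) p.414, (2.10) p.426] -/
def cdDipU (d : ℕ) (L : ℝ) (N : ℕ) (Cst CM δ₁ a σ τ : ℝ) : ℝ :=
  cdWU d L N Cst CM δ₁ a σ τ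
    + (seqCU d L N Cst (Cst * (1 + Real.exp 1 * σ)) σ τ (σ ^ 2) (kapU d a σ) (δ₁ / 2 / 2 / L)
        (cvWU d L N Cst CM δ₁ a σ τ) (cdWU d L N Cst CM δ₁ a σ τ) 1).2.2

/-- **`(ε^d)^{−1}ε^{−1}·cvDip ≤ cvDipU`** and **`(ε^d)^{−1}ε^{−1}·cdDip ≤ cdDipU`** (`L > 1`, `1 ≤ k`, `L^kε ≤ 1`, `a > 0`, `δ₁ > 0`, `C, C_M, s, δ_A ≥ 0`,
`L^k|e|δ_A ≤ τ`). [cite: Balaban1983Higgs3, (1.16) p.414, Prop. 1 pp.420–421, (2.10) p.426] -/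
theorem cvDip_cdDip_currency (hL : 1 < P.L) (hk : 1 ≤ k) (hmesh : P.mesh k ≤ 1) (ha : 0 < a) (hδ₁ : 0 < δ₁) (hCst : 0 ≤ Cst)
    (hCM : 0 ≤ CM) (hs : 0 ≤ s) (hδA : 0 ≤ δA) (hτ : (P.L : ℝ) ^ k * (|C.e| * δA) ≤ τ) :
    (P.mesh 0 ^ P.d)⁻¹ * (P.mesh 0)⁻¹ * cvDip P N C k a δ₁ Cst CM s δA ≤ cvDipU P.d (P.L : ℝ) N Cst CM δ₁ a (|C.e| * s) τ ∧
      (P.mesh 0 ^ P.d)⁻¹ * (P.mesh 0)⁻¹ * cdDip P N C k a δ₁ Cst CM s δA ≤ cdDipU P.d (P.L : ℝ) N Cst CM δ₁ a (|C.e| * s) τ := by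
  have hν : 0 ≤ (P.mesh 0 ^ P.d)⁻¹ * (P.mesh 0)⁻¹ :=
    mul_nonneg (inv_nonneg.mpr (pow_nonneg (P.mesh_pos 0).le _)) (inv_nonneg.mpr (P.mesh_pos 0).le)
  have hv0 := cvW_nonneg (P := P) (N := N) (C := C) (k := k) hL hδ₁ hCst hCM ha.le hs hδA
  have hd0 := cdW_nonneg (P := P) (N := N) (C := C) (k := k) hL hδ₁ hCst hCM ha.le hs hδA
  obtain ⟨hr0, -, -, -⟩ := seedRate_pos_le (P := P) hδ₁
  have hstep := seqC_currency (δ₀ := δ₁ / 2 / 2 / P.L) (cv₀ := cvW P N C k a δ₁ Cst CM s δA) (cd₀ := cdW P N C k a δ₁ Cst CM s δA) hL hk hmesh ha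
    hCst hs hδA hr0 hv0 hd0 hν (cvW_currency hL hδ₁ hCst hτ) (cdW_currency hL hδ₁ hCst hτ) hτ 1
  obtain ⟨-, -, hv1, hd1⟩ := seqC_pos (P := P) (N := N) (C := C) (k := k) (a := a) (Cst := Cst) (s := s) (δA := δA)
    (δ₀ := δ₁ / 2 / 2 / P.L) (cv₀ := cvW P N C k a δ₁ Cst CM s δA) (cd₀ := cdW P N C k a δ₁ Cst CM s δA) (δ₁ := δ₁ / 2 / 2 / P.L)
    hL hr0 le_rfl hv0 hd0 hCst hs hδA 1
  have hm := (P.mesh_pos k).le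
  constructor
  · unfold cvDip cvDipU
    rw [mul_add, ← mul_assoc]
    refine add_le_add (cvW_currency hL hδ₁ hCst hτ) ?_
    exact (mul_le_of_le_one_right (mul_nonneg hν hv1) hmesh).trans hstep.1
  · unfold cdDip cdDipU
    rw [mul_add, ← mul_assoc]
    refine add_le_add (cdW_currency hL hδ₁ hCst hτ) ?_
    exact (mul_le_of_le_one_right (mul_nonneg hν hd1) hmesh).trans hstep.2

/-- the dipole rate as a function of the real `L`: `δ₁/(4L)²` in p35's step form. [cite: Balaban1983Higgs3, (2.10) p.426] -/
def dipRate₀ (L δ₁ : ℝ) : ℝ := δ₁ / 2 / 2 / L / 2 / L / 2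

/-- `dipRate = dipRate₀` (definitional). [cite: Balaban1983Higgs3, (2.10) p.426] -/
theorem dipRate_eq₀ (δ₁ : ℝ) : dipRate P δ₁ = dipRate₀ (P.L : ℝ) δ₁ := rfl

/-- **the uniform mixed constant on the torus** `mixCU(d, L, N, C, C_M, δ₁, a, σ, τ; M) = #Ix·(seqCU … (dipRate₀; cvDipU, cdDipU) (M−1)).2.2/(L^{M−d} − 1)`
— NO `ε`, NO `k`. [cite: Balaban1983Higgs3, (1.16) p.414, Prop. 1 pp.420–421] -/
def mixCU (d : ℕ) (L : ℝ) (N : ℕ) (Cst CM δ₁ a σ τ : ℝ) (M : ℕ) : ℝ :=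
  (Fintype.card (Ix N) : ℝ) *
    ((seqCU d L N Cst (Cst * (1 + Real.exp 1 * σ)) σ τ (σ ^ 2) (kapU d a σ) (dipRate₀ L δ₁)
        (cvDipU d L N Cst CM δ₁ a σ τ) (cdDipU d L N Cst CM δ₁ a σ τ) (M - 1)).2.2
      / (L ^ ((M : ℝ) - (d : ℝ)) - 1))

/-- **THE MIXED CONSTANT OF (1.16) ON THE TORUS IS UNIFORM IN `ε` AND `k`**: for `L > 1`, `1 ≤ k`, `L^kε ≤ 1`, `a > 0`, `δ₁ > 0`, `C, C_M, s, δ_A ≥ 0`,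
`L^k|e|δ_A ≤ τ` and `d < M`: `mixC(k, a, δ₁, C, C_M, s, δ_A; M) ≤ mixCU(d, L, N, C, C_M, δ₁, a, |e|s, τ; M)` — the constant `C_M` of p40's binder `hM`
(`kernel116_mixed_le`) may be taken independent of the lattice spacing and of the scale. [cite: Balaban1983Higgs3, (1.16) p.414, Prop. 1 pp.420–421, (2.5) p.424] -/
theorem mixC_currency (hL : 1 < P.L) (hk : 1 ≤ k) (hmesh : P.mesh k ≤ 1) (ha : 0 < a) (hδ₁ : 0 < δ₁) (hCst : 0 ≤ Cst) (hCM : 0 ≤ CM)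
    (hs : 0 ≤ s) (hδA : 0 ≤ δA) (hτ : (P.L : ℝ) ^ k * (|C.e| * δA) ≤ τ) {M : ℕ} (hd : P.d < M) :
    mixC P N C k a δ₁ Cst CM s δA M ≤ mixCU P.d (P.L : ℝ) N Cst CM δ₁ a (|C.e| * s) τ M := by
  have hL1 : (1 : ℝ) < (P.L : ℝ) := by exact_mod_cast hL
  have hν : 0 ≤ (P.mesh 0 ^ P.d)⁻¹ * (P.mesh 0)⁻¹ :=
    mul_nonneg (inv_nonneg.mpr (pow_nonneg (P.mesh_pos 0).le _)) (inv_nonneg.mpr (P.mesh_pos 0).le)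
  obtain ⟨-, -, hv0, hd0⟩ := cvDip_cdDip_nonneg (P := P) (N := N) (C := C) (k := k) hL hδ₁ hCst hCM ha.le hs hδA
  obtain ⟨-, -, hr0, -⟩ := seedRate_pos_le (P := P) hδ₁
  obtain ⟨hv, hw⟩ := cvDip_cdDip_currency hL hk hmesh ha hδ₁ hCst hCM hs hδA hτ
  have hstep := (seqC_currency (δ₀ := dipRate P δ₁) (cv₀ := cvDip P N C k a δ₁ Cst CM s δA) (cd₀ := cdDip P N C k a δ₁ Cst CM s δA) hL hk hmesh
    ha hCst hs hδA hr0 hv0 hd0 hν hv hw hτ (M - 1)).2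
  have hdM : (P.d : ℝ) < (M : ℝ) := by exact_mod_cast hd
  have hD : 0 < (P.L : ℝ) ^ ((M : ℝ) - (P.d : ℝ)) - 1 := by
    have := Real.one_lt_rpow hL1 (show (0 : ℝ) < (M : ℝ) - (P.d : ℝ) by linarith); linarith
  unfold mixC mixCU dipRate₀
  rw [show ∀ X : ℝ, (P.mesh 0 ^ P.d)⁻¹ * (P.mesh 0)⁻¹ * (Fintype.card (Ix N) : ℝ) * (X / ((P.L : ℝ) ^ ((M : ℝ) - (P.d : ℝ)) - 1))
      = (Fintype.card (Ix N) : ℝ) * (((P.mesh 0 ^ P.d)⁻¹ * (P.mesh 0)⁻¹ * X) / ((P.L : ℝ) ^ ((M : ℝ) - (P.d : ℝ)) - 1)) from fun X => by ring]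
  exact mul_le_mul_of_nonneg_left (div_le_div_of_nonneg_right hstep hD.le) (Nat.cast_nonneg _)

end Torus

/-! ## §4 The box mixed member of route γ′ in uniform currency -/

section Box

/-- the uniform twin of the box seed's value constant `cvS`: `cvWU + n_F·#Ix·4dσ·C²·faceKfar₀(δ₁,1,2,θ)`. [cite: Balaban1983Higgs3, (1.16) p.414, (2.10) p.426, p.433] -/
def cvSU (d : ℕ) (L : ℝ) (N nF : ℕ) (Cst CM δ₁ a σ τ θ : ℝ) : ℝ :=
  cvWU d L N Cst CM δ₁ a σ τ + (nF : ℝ) * ((Fintype.card (Ix N) : ℝ) * (4 * (d : ℝ) * σ * (Cst * Cst * faceKfar₀ d L δ₁ 1 2 θ)))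

/-- the uniform twin of the box seed's sheet constant `cSS`: `4dσ·C(1+e)`. [cite: Balaban1983Higgs3, (1.16) p.414, p.433] -/
def cSSU (d : ℕ) (Cst σ : ℝ) : ℝ := 4 * (d : ℝ) * σ * (Cst * (1 + Real.exp 1))

/-- the uniform twin of `cv1` (the far step of the seed, value column). [cite: Balaban1983Higgs3, (1.16) p.414, (2.10) p.426] -/
def cv1U (d : ℕ) (L : ℝ) (N nF : ℕ) (Cst CM δ₁ a σ τ θ : ℝ) : ℝ :=
  stepBoxVCfarU d L N nF (δ₁ / 2 / 2 / L / 2) 2 2 Cst (cvSU d L N nF Cst CM δ₁ a σ τ θ) (cdWU d L N Cst CM δ₁ a σ τ) (cSSU d Cst σ)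
    (Cst * (1 + Real.exp 1)) σ τ (σ ^ 2) (kapU d a σ) (kapFU d σ τ) θ

/-- the uniform twin of `cd1` (the far step of the seed, derivative column). [cite: Balaban1983Higgs3, (1.16) p.414, (2.10) p.426] -/
def cd1U (d : ℕ) (L : ℝ) (N nF : ℕ) (Cst CM δ₁ a σ τ θ : ℝ) : ℝ :=
  stepBoxCfarU d L N nF (δ₁ / 2 / 2 / L / 2) 1 2 (Cst * (1 + Real.exp 1)) (cvSU d L N nF Cst CM δ₁ a σ τ θ) (cdWU d L N Cst CM δ₁ a σ τ)
    (cSSU d Cst σ) (Cst * (1 + Real.exp 1)) σ τ (σ ^ 2) (kapU d a σ) θ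

/-- the uniform twins of the weakened seed `(cvD, cdD, cSD)`: `cvSU + cv1U`, `cdWU + cd1U`, `cSSU + kapFU·cvSU` (one `L^kε ≤ 1` each).
[cite: Balaban1983Higgs3, (1.16) p.414, (2.10) p.426, p.433] -/
def cvDU (d : ℕ) (L : ℝ) (N nF : ℕ) (Cst CM δ₁ a σ τ θ : ℝ) : ℝ := cvSU d L N nF Cst CM δ₁ a σ τ θ + cv1U d L N nF Cst CM δ₁ a σ τ θ

/-- see `cvDU`. [cite: Balaban1983Higgs3, (1.16) p.414, (2.10) p.426] -/
def cdDU (d : ℕ) (L : ℝ) (N nF : ℕ) (Cst CM δ₁ a σ τ θ : ℝ) : ℝ := cdWU d L N Cst CM δ₁ a σ τ + cd1U d L N nF Cst CM δ₁ a σ τ θ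

/-- see `cvDU`. [cite: Balaban1983Higgs3, (1.16) p.414, p.433] -/
def cSDU (d : ℕ) (L : ℝ) (N nF : ℕ) (Cst CM δ₁ a σ τ θ : ℝ) : ℝ := cSSU d Cst σ + kapFU d σ τ * cvSU d L N nF Cst CM δ₁ a σ τ θ

/-- **the uniform twin of the recursion `seqM`** from a seed state `(r₀; v₀, w₀, S₀)`: state `1` = the far steps, state `J+2` = C2's box steps, sheet
`K_F·v`. [cite: Balaban1983Higgs3, (1.16) p.414, Prop. 1 pp.420–421, (2.10) p.426, p.433] -/
def seqMU (d : ℕ) (L : ℝ) (N nF : ℕ) (Ĉ Ĉe κ₁ τ κ₃ K₄ KF θ r₀ v₀ w₀ S₀ : ℝ) : ℕ → ℝ × ℝ × ℝ × ℝ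
  | 0 => (r₀, v₀, w₀, S₀)
  | 1 =>
    (r₀ / 2 / L / 2,
      stepBoxVCfarU d L N nF r₀ 2 2 Ĉ v₀ w₀ S₀ Ĉe κ₁ τ κ₃ K₄ KF θ,
      stepBoxCfarU d L N nF r₀ 1 2 Ĉe v₀ w₀ S₀ Ĉe κ₁ τ κ₃ K₄ θ,
      KF * v₀)
  | J + 2 =>
    ((seqMU d L N nF Ĉ Ĉe κ₁ τ κ₃ K₄ KF θ r₀ v₀ w₀ S₀ (J + 1)).1 / 2 / L / 2,
      stepBoxVCU d L N nF (seqMU d L N nF Ĉ Ĉe κ₁ τ κ₃ K₄ KF θ r₀ v₀ w₀ S₀ (J + 1)).1 2 (2 + ((J + 1 : ℕ) : ℝ)) Ĉ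
        (seqMU d L N nF Ĉ Ĉe κ₁ τ κ₃ K₄ KF θ r₀ v₀ w₀ S₀ (J + 1)).2.1 (seqMU d L N nF Ĉ Ĉe κ₁ τ κ₃ K₄ KF θ r₀ v₀ w₀ S₀ (J + 1)).2.2.1
        (seqMU d L N nF Ĉ Ĉe κ₁ τ κ₃ K₄ KF θ r₀ v₀ w₀ S₀ (J + 1)).2.2.2 Ĉe κ₁ τ κ₃ K₄ KF,
      stepBoxCU d L N nF (seqMU d L N nF Ĉ Ĉe κ₁ τ κ₃ K₄ KF θ r₀ v₀ w₀ S₀ (J + 1)).1 1 (2 + ((J + 1 : ℕ) : ℝ)) Ĉe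
        (seqMU d L N nF Ĉ Ĉe κ₁ τ κ₃ K₄ KF θ r₀ v₀ w₀ S₀ (J + 1)).2.1 (seqMU d L N nF Ĉ Ĉe κ₁ τ κ₃ K₄ KF θ r₀ v₀ w₀ S₀ (J + 1)).2.2.1
        (seqMU d L N nF Ĉ Ĉe κ₁ τ κ₃ K₄ KF θ r₀ v₀ w₀ S₀ (J + 1)).2.2.2 Ĉe κ₁ τ κ₃ K₄,
      KF * (seqMU d L N nF Ĉ Ĉe κ₁ τ κ₃ K₄ KF θ r₀ v₀ w₀ S₀ (J + 1)).2.1)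

/-- the uniform box recursion at the weakened dipole seed of route γ′. [cite: Balaban1983Higgs3, (1.16) p.414, (2.10) p.426, p.433] -/
def seqMU₁ (d : ℕ) (L : ℝ) (N nF : ℕ) (Cst CM δ₁ a σ τ θ : ℝ) : ℕ → ℝ × ℝ × ℝ × ℝ :=
  seqMU d L N nF Cst (Cst * (1 + Real.exp 1)) σ τ (σ ^ 2) (kapU d a σ) (kapFU d σ τ) θ (δ₁ / 2 / 2 / L / 2 / 2 / L / 2)
    (cvDU d L N nF Cst CM δ₁ a σ τ θ) (cdDU d L N nF Cst CM δ₁ a σ τ θ) (cSDU d L N nF Cst CM δ₁ a σ τ θ)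

/-- **the uniform mixed constant on a box** `mixCBU(d, L, N, n_F, C, C_M, δ₁, a, σ, τ, θ; M) = (w_{M−1} + n_F·S_{M−1}·C(1+e)·faceKfar₀(δ_{M−1}, 1, M, θ))
/(L^{M−d} − 1)` over `seqMU₁` — NO `ε`, NO `k`. [cite: Balaban1983Higgs3, (1.16) p.414, Prop. 1 pp.420–421, p.433] -/
def mixCBU (d : ℕ) (L : ℝ) (N nF : ℕ) (Cst CM δ₁ a σ τ θ : ℝ) (M : ℕ) : ℝ :=
  ((seqMU₁ d L N nF Cst CM δ₁ a σ τ θ (M - 1)).2.2.1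
      + (nF : ℝ) * ((seqMU₁ d L N nF Cst CM δ₁ a σ τ θ (M - 1)).2.2.2 * (Cst * (1 + Real.exp 1)) *
          faceKfar₀ d L (seqMU₁ d L N nF Cst CM δ₁ a σ τ θ (M - 1)).1 1 (M : ℝ) θ))
    / (L ^ ((M : ℝ) - (d : ℝ)) - 1)

variable {C : ChargeData N} {k nF : ℕ} {a δ₁ Cst CM s δA τ θ : ℝ}

/-- **the box seed in uniform currency**: `ν·cvS ≤ cvSU`, `ν·cdS ≤ cdWU`, `νε·cSS ≤ cSSU` (`= cSSU` in fact) with `ν = (ε^d)^{−1}ε^{−1}`.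
[cite: Balaban1983Higgs3, (1.16) p.414, Prop. 1 pp.420–421, p.433] -/
theorem seedS_currency (hL : 1 < P.L) (hδ₁ : 0 < δ₁) (hCst : 0 ≤ Cst) (hτ : (P.L : ℝ) ^ k * (|C.e| * δA) ≤ τ) :
    (P.mesh 0 ^ P.d)⁻¹ * (P.mesh 0)⁻¹ * cvS P N C k nF a δ₁ Cst CM s δA θ ≤ cvSU P.d (P.L : ℝ) N nF Cst CM δ₁ a (|C.e| * s) τ θ ∧
      (P.mesh 0 ^ P.d)⁻¹ * (P.mesh 0)⁻¹ * cdS P N C k a δ₁ Cst CM s δA ≤ cdWU P.d (P.L : ℝ) N Cst CM δ₁ a (|C.e| * s) τ ∧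
      (P.mesh 0 ^ P.d)⁻¹ * (P.mesh 0)⁻¹ * P.mesh 0 * cSS P C Cst s ≤ cSSU P.d Cst (|C.e| * s) := by
  have hE0 : P.mesh 0 ^ P.d ≠ 0 := (pow_pos (P.mesh_pos 0) _).ne'
  have hε0 : P.mesh 0 ≠ 0 := (P.mesh_pos 0).ne'
  refine ⟨?_, by unfold cdS; exact cdW_currency hL hδ₁ hCst hτ, ?_⟩
  · have hsheet : (P.mesh 0 ^ P.d)⁻¹ * (P.mesh 0)⁻¹ *
        ((nF : ℝ) * (P.mesh 0 * 1 * ((Fintype.card (Ix N) : ℝ) * (shC P C s * (cK P Cst * cK P Cst * faceKfar P δ₁ 1 2 θ)))))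
        = (nF : ℝ) * ((Fintype.card (Ix N) : ℝ) * (4 * (P.d : ℝ) * (|C.e| * s) * (Cst * Cst * faceKfar₀ P.d (P.L : ℝ) δ₁ 1 2 θ))) := by
      rw [faceKfar_eq, ← mesh_zero_mul_shC (P := P) C s]
      unfold cK
      field_simp
    unfold cvS cvSU
    rw [mul_add, hsheet]
    exact add_le_add (cvW_currency hL hδ₁ hCst hτ) le_rfl
  · have hid : (P.mesh 0 ^ P.d)⁻¹ * (P.mesh 0)⁻¹ * P.mesh 0 * cSS P C Cst s = cSSU P.d Cst (|C.e| * s) := by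
      unfold cSS cSSU cK
      rw [← mesh_zero_mul_shC (P := P) C s]
      field_simp
    exact hid.le

/-- **the weakened seed `(cvD, cdD, cSD)` in uniform currency** (`L > 1`, `1 ≤ k`, `L^kε ≤ 1`, `a > 0`, `δ₁ > 0`, `C, C_M, s, δ_A ≥ 0`, `θ > 0`,
`L^k|e|δ_A ≤ τ`): `ν·cvD ≤ cvDU`, `ν·cdD ≤ cdDU`, `νε·cSD ≤ cSDU` — the far step of the seed by `stepBoxVCfar_currency` / `stepBoxCfar_currency`,
the extra `L^kε ≤ 1` of the weakening dropped. [cite: Balaban1983Higgs3, (1.16) p.414, Prop. 1 pp.420–421, (2.10) p.426, p.433] -/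
theorem seedD_currency (hL : 1 < P.L) (hk : 1 ≤ k) (hmesh : P.mesh k ≤ 1) (ha : 0 < a) (hδ₁ : 0 < δ₁) (hCst : 0 ≤ Cst) (hCM : 0 ≤ CM)
    (hs : 0 ≤ s) (hδA : 0 ≤ δA) (hθ : 0 < θ) (hτ : (P.L : ℝ) ^ k * (|C.e| * δA) ≤ τ) :
    (P.mesh 0 ^ P.d)⁻¹ * (P.mesh 0)⁻¹ * cvD P N C k nF a δ₁ Cst CM s δA θ ≤ cvDU P.d (P.L : ℝ) N nF Cst CM δ₁ a (|C.e| * s) τ θ ∧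
      (P.mesh 0 ^ P.d)⁻¹ * (P.mesh 0)⁻¹ * cdD P N C k nF a δ₁ Cst CM s δA θ ≤ cdDU P.d (P.L : ℝ) N nF Cst CM δ₁ a (|C.e| * s) τ θ ∧
      (P.mesh 0 ^ P.d)⁻¹ * (P.mesh 0)⁻¹ * P.mesh 0 * cSD P N C k nF a δ₁ Cst CM s δA θ ≤ cSDU P.d (P.L : ℝ) N nF Cst CM δ₁ a (|C.e| * s) τ θ := by
  have hν : 0 ≤ (P.mesh 0 ^ P.d)⁻¹ * (P.mesh 0)⁻¹ :=
    mul_nonneg (inv_nonneg.mpr (pow_nonneg (P.mesh_pos 0).le _)) (inv_nonneg.mpr (P.mesh_pos 0).le)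
  have hε : 0 ≤ P.mesh 0 := (P.mesh_pos 0).le
  have hm : 0 ≤ P.mesh k := (P.mesh_pos k).le
  obtain ⟨hvS, hdS, hSS, hv1, hd1, -, -, -⟩ := seed_consts_nonneg (P := P) (N := N) (C := C) (k := k) (nF := nF) hL hδ₁ hCst hCM ha.le hs hδA hθ
  obtain ⟨uv, uw, uS⟩ := seedS_currency (nF := nF) (a := a) (CM := CM) (θ := θ) hL hδ₁ hCst hτ
  have hσ : 0 ≤ |C.e| * s := mul_nonneg (abs_nonneg _) hs
  have hκ₂ : 0 ≤ (P.mesh 0)⁻¹ * (|C.e| * δA) := mul_nonneg (inv_nonneg.mpr (P.mesh_pos 0).le) (mul_nonneg (abs_nonneg _) hδA)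
  have hτ' : P.mesh k * ((P.mesh 0)⁻¹ * (|C.e| * δA)) ≤ τ := by rw [mesh_mul_inv_mesh_zero_mul]; exact hτ
  have hκ₄ : 0 ≤ kap4 P C k a s := kap4_nonneg hs
  have hK₄ : P.mesh k * kap4 P C k a s ≤ kapU P.d a (|C.e| * s) := mesh_mul_kap4_le hL hk hmesh ha hs
  have hκF : 0 ≤ kapF P C s δA := kapF_nonneg hs hδA
  have hKF : P.mesh 0 * kapF P C s δA ≤ kapFU P.d (|C.e| * s) τ := mesh_zero_mul_kapF_le hmesh hs hδA hτ
  have hcK : 0 ≤ cK P Cst := by unfold cK; positivity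
  have hcKe : 0 ≤ cKe P Cst := by unfold cKe cK; positivity
  obtain ⟨hr0, -, -, -⟩ := seedRateB_pos_le (P := P) hδ₁
  have hfar1 := stepBoxVCfar_currency (N := N) (nF := nF) hL hmesh hr0 (by norm_num : (1 : ℝ) ≤ 2) (by norm_num : (1 : ℝ) < 2) hθ hν hcK
    (inv_mul_cK (P := P) Cst).le hvS uv hdS uw hSS uS hcKe (inv_mul_cKe (P := P) Cst).le hσ hκ₂ hτ' (sq_nonneg (|C.e| * s)) hκ₄ hK₄ hκF hKF
  have hfar2 := stepBoxCfar_currency (N := N) (nF := nF) hL hmesh hr0 (by norm_num : (0 : ℝ) < 1) (by norm_num : (1 : ℝ) < 2) hθ hν hcKe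
    (inv_mul_cKe (P := P) Cst).le hvS uv hdS uw hSS uS hcKe (inv_mul_cKe (P := P) Cst).le hσ hκ₂ hτ' (sq_nonneg (|C.e| * s)) hκ₄ hK₄
  refine ⟨?_, ?_, ?_⟩
  · unfold cvD cvDU cv1U
    rw [mul_add, ← mul_assoc]
    refine add_le_add uv ((mul_le_of_le_one_right (mul_nonneg hν hv1) hmesh).trans ?_)
    unfold cv1; exact hfar1
  · unfold cdD cdDU cd1U
    rw [mul_add, ← mul_assoc]
    refine add_le_add uw ((mul_le_of_le_one_right (mul_nonneg hν hd1) hmesh).trans ?_)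
    unfold cd1; exact hfar2
  · unfold cSD cSDU
    rw [mul_add]
    refine add_le_add uS ?_
    rw [show (P.mesh 0 ^ P.d)⁻¹ * (P.mesh 0)⁻¹ * P.mesh 0 * (kapF P C s δA * cvS P N C k nF a δ₁ Cst CM s δA θ * P.mesh k)
        = ((P.mesh 0 * kapF P C s δA) * ((P.mesh 0 ^ P.d)⁻¹ * (P.mesh 0)⁻¹ * cvS P N C k nF a δ₁ Cst CM s δA θ)) * P.mesh k by ring]
    refine (mul_le_of_le_one_right (mul_nonneg (mul_nonneg hε hκF) (mul_nonneg hν hvS)) hmesh).trans ?_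
    exact mul_le_mul hKF uv (mul_nonneg hν hvS) ((mul_nonneg hε hκF).trans hKF)

/-- the rate components of `seqM` and `seqMU₁` agree. [cite: Balaban1983Higgs3, (2.10) p.426] -/
theorem seqMU_rate (J : ℕ) :
    (seqMU₁ P.d (P.L : ℝ) N nF Cst CM δ₁ a (|C.e| * s) τ θ J).1 = rateM P N C k nF a δ₁ Cst CM s δA θ J := by
  induction J with
  | zero => rfl
  | succ J ih =>
    cases J with
    | zero => rfl
    | succ J =>
      rw [(seqM_succ_succ (P := P) (N := N) (C := C) (k := k) (nF := nF) (a := a) (δ₁ := δ₁) (Cst := Cst) (CM := CM) (s := s) (δA := δA)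
        (θ := θ) J).1, ← ih]
      rfl

/-- **THE BOX MIXED RECURSION IN UNIFORM CURRENCY**: under the hypotheses of `seedD_currency`, for every `J`, with `ν = (ε^d)^{−1}ε^{−1}`:
`ν·cvM(J) ≤ (seqMU₁ … J).2.1`, `ν·cdM(J) ≤ (seqMU₁ … J).2.2.1`, `νε·cSM(J) ≤ (seqMU₁ … J).2.2.2`. [cite: Balaban1983Higgs3, (1.16) p.414, Prop. 1 pp.420–421, (2.10) p.426, p.433] -/
theorem seqM_currency (hL : 1 < P.L) (hk : 1 ≤ k) (hmesh : P.mesh k ≤ 1) (ha : 0 < a) (hδ₁ : 0 < δ₁) (hCst : 0 ≤ Cst) (hCM : 0 ≤ CM)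
    (hs : 0 ≤ s) (hδA : 0 ≤ δA) (hθ : 0 < θ) (hτ : (P.L : ℝ) ^ k * (|C.e| * δA) ≤ τ) (J : ℕ) :
    (P.mesh 0 ^ P.d)⁻¹ * (P.mesh 0)⁻¹ * cvM P N C k nF a δ₁ Cst CM s δA θ J ≤ (seqMU₁ P.d (P.L : ℝ) N nF Cst CM δ₁ a (|C.e| * s) τ θ J).2.1 ∧
      (P.mesh 0 ^ P.d)⁻¹ * (P.mesh 0)⁻¹ * cdM P N C k nF a δ₁ Cst CM s δA θ J ≤ (seqMU₁ P.d (P.L : ℝ) N nF Cst CM δ₁ a (|C.e| * s) τ θ J).2.2.1 ∧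
      (P.mesh 0 ^ P.d)⁻¹ * (P.mesh 0)⁻¹ * P.mesh 0 * cSM P N C k nF a δ₁ Cst CM s δA θ J ≤
        (seqMU₁ P.d (P.L : ℝ) N nF Cst CM δ₁ a (|C.e| * s) τ θ J).2.2.2 := by
  have hν : 0 ≤ (P.mesh 0 ^ P.d)⁻¹ * (P.mesh 0)⁻¹ :=
    mul_nonneg (inv_nonneg.mpr (pow_nonneg (P.mesh_pos 0).le _)) (inv_nonneg.mpr (P.mesh_pos 0).le)
  have hε : 0 ≤ P.mesh 0 := (P.mesh_pos 0).le
  have hσ : 0 ≤ |C.e| * s := mul_nonneg (abs_nonneg _) hs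
  have hκ₂ : 0 ≤ (P.mesh 0)⁻¹ * (|C.e| * δA) := mul_nonneg (inv_nonneg.mpr (P.mesh_pos 0).le) (mul_nonneg (abs_nonneg _) hδA)
  have hτ' : P.mesh k * ((P.mesh 0)⁻¹ * (|C.e| * δA)) ≤ τ := by rw [mesh_mul_inv_mesh_zero_mul]; exact hτ
  have hκ₄ : 0 ≤ kap4 P C k a s := kap4_nonneg hs
  have hK₄ : P.mesh k * kap4 P C k a s ≤ kapU P.d a (|C.e| * s) := mesh_mul_kap4_le hL hk hmesh ha hs
  have hκF : 0 ≤ kapF P C s δA := kapF_nonneg hs hδA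
  have hKF : P.mesh 0 * kapF P C s δA ≤ kapFU P.d (|C.e| * s) τ := mesh_zero_mul_kapF_le hmesh hs hδA hτ
  have hcK : 0 ≤ cK P Cst := by unfold cK; positivity
  have hcKe : 0 ≤ cKe P Cst := by unfold cKe cK; positivity
  obtain ⟨dv, dw, dS⟩ := seedD_currency (nF := nF) hL hk hmesh ha hδ₁ hCst hCM hs hδA hθ hτ
  induction J with
  | zero =>
    obtain ⟨-, e2, e3, e4⟩ := seqM_zero (P := P) (N := N) (C := C) (k := k) (nF := nF) (a := a) (δ₁ := δ₁) (Cst := Cst) (CM := CM) (s := s)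
      (δA := δA) (θ := θ)
    rw [e2, e3, e4]
    exact ⟨dv, dw, dS⟩
  | succ J ih =>
    obtain ⟨ihv, ihd, ihS⟩ := ih
    obtain ⟨hr0, -, hcvJ, hcdJ, hcSJ⟩ := seqM_pos (P := P) (N := N) (C := C) (k := k) (nF := nF) (a := a) (δ₁ := δ₁) (Cst := Cst)
      (CM := CM) (s := s) (δA := δA) (θ := θ) hL hδ₁ hCst hCM ha.le hs hδA hθ J
    have hrate := seqMU_rate (P := P) (N := N) (C := C) (k := k) (nF := nF) (a := a) (δ₁ := δ₁) (Cst := Cst) (CM := CM) (s := s) (δA := δA)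
      (τ := τ) (θ := θ) J
    cases J with
    | zero =>
      obtain ⟨-, e2, e3, e4⟩ := seqM_one (P := P) (N := N) (C := C) (k := k) (nF := nF) (a := a) (δ₁ := δ₁) (Cst := Cst) (CM := CM) (s := s)
        (δA := δA) (θ := θ)
      have er : rateM P N C k nF a δ₁ Cst CM s δA θ 0 = δ₁ / 2 / 2 / (P.L : ℝ) / 2 / 2 / (P.L : ℝ) / 2 :=
        (seqM_zero (P := P) (N := N) (C := C) (k := k) (nF := nF) (a := a) (δ₁ := δ₁) (Cst := Cst) (CM := CM) (s := s) (δA := δA)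
          (θ := θ)).1
      have hr0' : 0 < δ₁ / 2 / 2 / (P.L : ℝ) / 2 / 2 / (P.L : ℝ) / 2 := by rw [← er]; exact hr0
      refine ⟨?_, ?_, ?_⟩
      · show _ ≤ stepBoxVCfarU P.d (P.L : ℝ) N nF _ 2 2 Cst _ _ _ (Cst * (1 + Real.exp 1)) _ _ _ _ _ θ
        rw [e2, er]
        exact stepBoxVCfar_currency hL hmesh hr0' (by norm_num) (by norm_num) hθ hν hcK (inv_mul_cK (P := P) Cst).le hcvJ ihv hcdJ ihd hcSJ ihS
          hcKe (inv_mul_cKe (P := P) Cst).le hσ hκ₂ hτ' (sq_nonneg _) hκ₄ hK₄ hκF hKF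
      · show _ ≤ stepBoxCfarU P.d (P.L : ℝ) N nF _ 1 2 (Cst * (1 + Real.exp 1)) _ _ _ (Cst * (1 + Real.exp 1)) _ _ _ _ θ
        rw [e3, er]
        exact stepBoxCfar_currency hL hmesh hr0' (by norm_num) (by norm_num) hθ hν hcKe (inv_mul_cKe (P := P) Cst).le hcvJ ihv hcdJ ihd hcSJ
          ihS hcKe (inv_mul_cKe (P := P) Cst).le hσ hκ₂ hτ' (sq_nonneg _) hκ₄ hK₄
      · show _ ≤ kapFU P.d (|C.e| * s) τ * _
        rw [e4, show (P.mesh 0 ^ P.d)⁻¹ * (P.mesh 0)⁻¹ * P.mesh 0 * (kapF P C s δA * cvM P N C k nF a δ₁ Cst CM s δA θ 0)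
          = (P.mesh 0 * kapF P C s δA) * ((P.mesh 0 ^ P.d)⁻¹ * (P.mesh 0)⁻¹ * cvM P N C k nF a δ₁ Cst CM s δA θ 0) by ring]
        exact mul_le_mul hKF ihv (mul_nonneg hν hcvJ) ((mul_nonneg hε hκF).trans hKF)
    | succ J =>
      obtain ⟨-, e2, e3, e4⟩ := seqM_succ_succ (P := P) (N := N) (C := C) (k := k) (nF := nF) (a := a) (δ₁ := δ₁) (Cst := Cst) (CM := CM)
        (s := s) (δA := δA) (θ := θ) J
      have hJ : (2 : ℝ) ≤ 2 + ((J + 1 : ℕ) : ℝ) := by have := (Nat.cast_nonneg (J + 1) : (0 : ℝ) ≤ ((J + 1 : ℕ) : ℝ)); linarith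
      unfold seqMU₁ at hrate
      refine ⟨?_, ?_, ?_⟩
      · show _ ≤ stepBoxVCU P.d (P.L : ℝ) N nF _ 2 (2 + ((J + 1 : ℕ) : ℝ)) Cst _ _ _ (Cst * (1 + Real.exp 1)) _ _ _ _ _
        rw [e2, hrate]
        exact stepBoxVC_currency hL hmesh hr0 (by norm_num) hJ hν hcK (inv_mul_cK (P := P) Cst).le hcvJ ihv hcdJ ihd hcSJ ihS hcKe
          (inv_mul_cKe (P := P) Cst).le hσ hκ₂ hτ' (sq_nonneg _) hκ₄ hK₄ hκF hKF
      · show _ ≤ stepBoxCU P.d (P.L : ℝ) N nF _ 1 (2 + ((J + 1 : ℕ) : ℝ)) (Cst * (1 + Real.exp 1)) _ _ _ (Cst * (1 + Real.exp 1)) _ _ _ _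
        rw [e3, hrate]
        exact stepBoxC_currency hL hmesh hr0 (by norm_num) hJ hν hcKe (inv_mul_cKe (P := P) Cst).le hcvJ ihv hcdJ ihd hcSJ ihS hcKe
          (inv_mul_cKe (P := P) Cst).le hσ hκ₂ hτ' (sq_nonneg _) hκ₄ hK₄
      · show _ ≤ kapFU P.d (|C.e| * s) τ * _
        rw [e4, show (P.mesh 0 ^ P.d)⁻¹ * (P.mesh 0)⁻¹ * P.mesh 0 * (kapF P C s δA * cvM P N C k nF a δ₁ Cst CM s δA θ (J + 1))
          = (P.mesh 0 * kapF P C s δA) * ((P.mesh 0 ^ P.d)⁻¹ * (P.mesh 0)⁻¹ * cvM P N C k nF a δ₁ Cst CM s δA θ (J + 1)) by ring]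
        exact mul_le_mul hKF ihv (mul_nonneg hν hcvJ) ((mul_nonneg hε hκF).trans hKF)

/-- **THE MIXED CONSTANT OF (1.16) ON A BOX (ROUTE γ′) IS UNIFORM IN `ε` AND `k`**: for `L > 1`, `1 ≤ k`, `L^kε ≤ 1`, `a > 0`, `δ₁ > 0`,
`C, C_M, s, δ_A ≥ 0`, `θ > 0`, `L^k|e|δ_A ≤ τ` and `d < M`: `mixCB(k, n_F, a, δ₁, C, C_M, s, δ_A, θ; M) ≤ mixCBU(d, L, N, n_F, C, C_M, δ₁, a, |e|s, τ, θ; M)`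
— the constant `C_M = mixCB·#Ix` of the binder `h_M` on `□` (`kernel116_mixed_cellBox_interior_le`) may be taken independent of the lattice
spacing and of the scale, as Prop. 1 states. [cite: Balaban1983Higgs3, (1.16) p.414, Prop. 1 pp.420–421, (2.5) p.424, p.433] -/
theorem mixCB_currency (hL : 1 < P.L) (hk : 1 ≤ k) (hmesh : P.mesh k ≤ 1) (ha : 0 < a) (hδ₁ : 0 < δ₁) (hCst : 0 ≤ Cst) (hCM : 0 ≤ CM)
    (hs : 0 ≤ s) (hδA : 0 ≤ δA) (hθ : 0 < θ) (hτ : (P.L : ℝ) ^ k * (|C.e| * δA) ≤ τ) {M : ℕ} (hd : P.d < M) :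
    mixCB P N C k nF a δ₁ Cst CM s δA θ M ≤ mixCBU P.d (P.L : ℝ) N nF Cst CM δ₁ a (|C.e| * s) τ θ M := by
  have hL1 : (1 : ℝ) < (P.L : ℝ) := by exact_mod_cast hL
  have hE0 : P.mesh 0 ^ P.d ≠ 0 := (pow_pos (P.mesh_pos 0) _).ne'
  have hε0 : P.mesh 0 ≠ 0 := (P.mesh_pos 0).ne'
  have hν : 0 ≤ (P.mesh 0 ^ P.d)⁻¹ * (P.mesh 0)⁻¹ :=
    mul_nonneg (inv_nonneg.mpr (pow_nonneg (P.mesh_pos 0).le _)) (inv_nonneg.mpr (P.mesh_pos 0).le)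
  have hε : 0 ≤ P.mesh 0 := (P.mesh_pos 0).le
  have hcKe : 0 ≤ cKe P Cst := by unfold cKe cK; positivity
  obtain ⟨-, hw, hS⟩ := seqM_currency (nF := nF) hL hk hmesh ha hδ₁ hCst hCM hs hδA hθ hτ (M - 1)
  obtain ⟨hr0, -, -, -, hcS⟩ := seqM_pos (P := P) (N := N) (C := C) (k := k) (nF := nF) (a := a) (δ₁ := δ₁) (Cst := Cst) (CM := CM)
    (s := s) (δA := δA) (θ := θ) hL hδ₁ hCst hCM ha.le hs hδA hθ (M - 1)
  have hM1 : (1 : ℝ) ≤ (M : ℝ) := by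
    have : 1 ≤ M := by have := P.hd; omega
    exact_mod_cast this
  have hF : 0 ≤ faceKfar₀ P.d (P.L : ℝ) (rateM P N C k nF a δ₁ Cst CM s δA θ (M - 1)) 1 (M : ℝ) θ := faceKfar₀_nonneg P.hd hL1 hr0 hθ hM1
  have hXS : 0 ≤ (P.mesh 0 ^ P.d)⁻¹ * (P.mesh 0)⁻¹ * P.mesh 0 * cSM P N C k nF a δ₁ Cst CM s δA θ (M - 1) := mul_nonneg (mul_nonneg hν hε) hcS
  have hXe : 0 ≤ (P.mesh 0 ^ P.d)⁻¹ * cKe P Cst := mul_nonneg (inv_nonneg.mpr (pow_nonneg (P.mesh_pos 0).le _)) hcKe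
  -- the sheet summand of the numerator in uniform currency
  have key : (P.mesh 0 ^ P.d)⁻¹ * (P.mesh 0)⁻¹ *
      ((nF : ℝ) * (cSM P N C k nF a δ₁ Cst CM s δA θ (M - 1) * cKe P Cst * faceKfar P (rateM P N C k nF a δ₁ Cst CM s δA θ (M - 1)) 1 (M : ℝ) θ))
      ≤ (nF : ℝ) * ((seqMU₁ P.d (P.L : ℝ) N nF Cst CM δ₁ a (|C.e| * s) τ θ (M - 1)).2.2.2 * (Cst * (1 + Real.exp 1)) *
          faceKfar₀ P.d (P.L : ℝ) (rateM P N C k nF a δ₁ Cst CM s δA θ (M - 1)) 1 (M : ℝ) θ) := by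
    rw [faceKfar_eq]
    have h := prod3_le zero_le_one hXS hXe hF le_rfl hS (inv_mul_cKe (P := P) Cst).le
    calc _ = (nF : ℝ) * (1 * (((P.mesh 0 ^ P.d)⁻¹ * (P.mesh 0)⁻¹ * P.mesh 0 * cSM P N C k nF a δ₁ Cst CM s δA θ (M - 1))
          * ((P.mesh 0 ^ P.d)⁻¹ * cKe P Cst)) * faceKfar₀ P.d (P.L : ℝ) (rateM P N C k nF a δ₁ Cst CM s δA θ (M - 1)) 1 (M : ℝ) θ) := by
            ring
      _ ≤ (nF : ℝ) * (1 * ((seqMU₁ P.d (P.L : ℝ) N nF Cst CM δ₁ a (|C.e| * s) τ θ (M - 1)).2.2.2 * (Cst * (1 + Real.exp 1)))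
          * faceKfar₀ P.d (P.L : ℝ) (rateM P N C k nF a δ₁ Cst CM s δA θ (M - 1)) 1 (M : ℝ) θ) :=
            mul_le_mul_of_nonneg_left h (Nat.cast_nonneg _)
      _ = _ := by ring
  -- the numerator in uniform currency
  have hnum : (P.mesh 0 ^ P.d)⁻¹ * (P.mesh 0)⁻¹ *
      (cdM P N C k nF a δ₁ Cst CM s δA θ (M - 1)
        + (nF : ℝ) * (cSM P N C k nF a δ₁ Cst CM s δA θ (M - 1) * cKe P Cst *
            faceKfar P (rateM P N C k nF a δ₁ Cst CM s δA θ (M - 1)) 1 (M : ℝ) θ))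
      ≤ (seqMU₁ P.d (P.L : ℝ) N nF Cst CM δ₁ a (|C.e| * s) τ θ (M - 1)).2.2.1
        + (nF : ℝ) * ((seqMU₁ P.d (P.L : ℝ) N nF Cst CM δ₁ a (|C.e| * s) τ θ (M - 1)).2.2.2 * (Cst * (1 + Real.exp 1)) *
            faceKfar₀ P.d (P.L : ℝ) (rateM P N C k nF a δ₁ Cst CM s δA θ (M - 1)) 1 (M : ℝ) θ) := by
    rw [mul_add]
    exact add_le_add hw key
  have hdM : (P.d : ℝ) < (M : ℝ) := by exact_mod_cast hd
  have hD : 0 < (P.L : ℝ) ^ ((M : ℝ) - (P.d : ℝ)) - 1 := by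
    have := Real.one_lt_rpow hL1 (show (0 : ℝ) < (M : ℝ) - (P.d : ℝ) by linarith); linarith
  unfold mixCB mixCBU
  rw [seqMU_rate (P := P) (N := N) (C := C) (k := k) (nF := nF) (a := a) (δ₁ := δ₁) (Cst := Cst) (CM := CM) (s := s) (δA := δA) (τ := τ)
    (θ := θ) (M - 1), ← mul_div_assoc]
  exact div_le_div_of_nonneg_right hnum hD.le

end Box

end Literature.MathematicalPhysics.QuantumFieldTheory.Balaban1983to89.B3Op116MixedCurrency
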